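import Mathlib.Analysis.Matrix.Spectrum
import Mathlib.LinearAlgebra.Matrix.Charpoly.Eigs
import Literature.MathematicalPhysics.QuantumLattice.AbelianFluxSectors
import Literature.MathematicalPhysics.QuantumLattice.WilsonDiracLowerBound
import Literature.MathematicalPhysics.QuantumLattice.OverlapDirac
import HarnessLib

/-!
# Lüscher's flux-sector fields: constant field tensor, admissibility, and the spectral gap of `Γ₅ D_W`

Topic `Literature/MathematicalPhysics/QuantumLattice`; namespace `Literature.MathematicalPhysics.QuantumLattice`.
Companion (proofs only, no definitions, no named facts) of `AbelianFluxSectors.lean`, which defines Lüscher's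
sector representative `fluxSectorField L m = V_{[m]}` [Luscher1999AbelianChiral, §7.2 (7.10)] and states the
finite-volume abelian index formula `IOSFluxSectorIndex` [IgarashiOkuyamaSuzuki2002, Thm 3.1, (2.3), (3.4)] as a
named fact.  This file proves the bottom layer of the printed argument — everything about `V_{[m]}` and about the
Hermitian Wilson–Dirac operator `H = Γ₅ D_W(V_{[m]}, −1, 1)` that does NOT require the anomaly machinery:

* `plaquetteHolonomy_fluxSectorField` — Lüscher's sentence after (7.10), "this field is periodic and can be shown to
  have constant field tensor equal to `2π m_{μν}/L²`": for anti-symmetric `m` and `L ≥ 1` every plaquette holonomy of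
  `V_{[m]}` in the `(μ,ν)` plane is `exp(2πi m_{μν}/L²)` (the plaquette angle computed from the phases is
  `2π m_{μν}/L² − 2π m_{μν} δ_{x_μ,L−1} δ_{x_ν,L−1}`, `fluxSectorPhase_plaquette`);
* `norm_one_sub_u1Rep_plaquetteHolonomy_fluxSectorField_le`, `isNormAdmissible_fluxSectorField` — hence
  `‖1 − V_{[m]}(p)‖ ≤ 2π|m_{μν}|/L²`, and `V_{[m]}` is admissible with `ε = 1/50` under the hypothesis
  `2π|m_{μν}| ≤ L²/50` of `IOSFluxSectorIndex` [Luscher1999AbelianChiral, §7.2, the bound (7.9)];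
* `fluxSectorField_wilsonDirac_normSq_ge`, `det_gammaFive_mul_wilsonDirac_fluxSectorField_ne_zero`,
  `isHermitian_gammaFive_mul_wilsonDirac_fluxSectorField` — by Neuberger's lower bound (tree theorem
  `wilsonDirac_normSq_mulVec_ge_of_plaquette`, [Neuberger2000Bounds]) `‖D_W(V_{[m]},−1,1)v‖² ≥ (2/5)‖v‖²`, so `H` is an
  invertible Hermitian matrix: the negative-eigenvalue count in `IOSFluxSectorIndex` is taken at a point with no zero
  modes, as the index theorem requires;
* generic spectral bookkeeping for Hermitian matrices (`countP_neg_add_countP_pos_of_isHermitian`: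
  `N₋ + N₊ = dim` when `det ≠ 0`; `charpoly_neg_eq`, `roots_charpoly_neg`,
  `roots_charpoly_map_neg_of_conj_eq_neg`, `two_mul_countP_neg_eq_card_of_isHermitian`: a Hermitian matrix conjugate
  to its negative has `2N₋ = dim`), and the instance `countP_neg_add_countP_pos_fluxSectorField` (`N₋ + N₊ = 4L⁴`).

What is NOT here: the index formula itself (`IOSFluxSectorIndex_holds`).  Its printed proof [IgarashiOkuyamaSuzuki2002,
§3] needs the locality of the overlap operator [HernandezJansenLuscher1999] (tree fact `HJLLocality`, undischarged),
Lüscher's classification of gauge-invariant topological fields on the infinite lattice [Luscher1999AbelianTopology],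
the classical-continuum-limit value of the anomaly coefficient [Adams2002AxialAnomaly], and the torus/infinite-lattice
comparison (2.7); none of these is in the tree yet.

## References

* M. Lüscher, Nucl. Phys. B 549 (1999) 295–334, arXiv:hep-lat/9811032, §7.2 (7.9)–(7.10). [Luscher1999AbelianChiral]
* H. Igarashi, K. Okuyama, H. Suzuki, Nucl. Phys. B 644 (2002) 383–394, arXiv:hep-lat/0206003, §2–§3. [IgarashiOkuyamaSuzuki2002]
* H. Neuberger, Phys. Rev. D 61 (2000) 085015, arXiv:hep-lat/9911004 [Neuberger2000Bounds]; Phys. Lett. B 417 (1998) 141 [Neuberger1998].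
-/

noncomputable section

open Matrix Finset Polynomial
open Literature.Probability.LatticeModels (TorusSite)
open Literature.MathematicalPhysics.QuantumFieldTheory

namespace Literature.MathematicalPhysics.QuantumLattice

/-! ### Spectral bookkeeping for Hermitian matrices -/

section Spectral

variable {n : Type*} [Fintype n] [DecidableEq n]

/-- **`N₋ + N₊ = dim`** for an invertible Hermitian matrix: the numbers of negative and of positive
roots of the characteristic polynomial (with multiplicity) add up to the size — the roots are the (real)
eigenvalues, none of which vanishes. [folklore] -/
theorem countP_neg_add_countP_pos_of_isHermitian {A : Matrix n n ℂ} (hA : A.IsHermitian)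
    (hdet : A.det ≠ 0) :
    A.charpoly.roots.countP (fun z => z.re < 0) + A.charpoly.roots.countP (fun z => 0 < z.re) =
      Fintype.card n := by
  -- roots of `χ_A` = eigenvalues (with multiplicity), so both counts are counts of eigenvalues
  have key : ∀ (p : ℝ → Prop) [DecidablePred p], A.charpoly.roots.countP (fun z => p z.re) =
      (Finset.univ.filter fun i => p (hA.eigenvalues i)).card := by
    intro p _
    rw [hA.roots_charpoly_eq_eigenvalues, Multiset.countP_map]
    simp only [Function.comp_apply]
    rw [← Finset.filter_val, Finset.card_val]
    rfl
  rw [key (fun t => t < 0), key (fun t => 0 < t)]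
  have h0 : ∀ i, hA.eigenvalues i ≠ 0 := by
    intro i hi
    apply hdet
    rw [hA.det_eq_prod_eigenvalues]
    exact Finset.prod_eq_zero (Finset.mem_univ i) (by simp [hi])
  have hcongr : (Finset.univ.filter fun i => 0 < hA.eigenvalues i) =
      Finset.univ.filter fun i => ¬ hA.eigenvalues i < 0 := by
    refine Finset.filter_congr fun i _ => ?_
    constructor
    · intro h; exact not_lt.mpr h.le
    · intro h; exact lt_of_le_of_ne (not_lt.mp h) (h0 i).symm
  rw [hcongr, Finset.card_filter_add_card_filter_not, Finset.card_univ]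

/-- The characteristic polynomial of `−M`: `χ_{−M}(X) = (−1)^n χ_M(−X)`. [folklore] -/
theorem charpoly_neg_eq {R : Type*} [CommRing R] (M : Matrix n n R) :
    (-M).charpoly = (-1) ^ Fintype.card n * M.charpoly.comp (-X) := by
  have h1 : M.charpoly.comp (-X) =
      ((charmatrix M).map (Polynomial.compRingHom (-X : R[X]))).det := by
    show Polynomial.compRingHom (-X : R[X]) (charmatrix M).det = _
    rw [RingHom.map_det]
    rfl
  have h2 : (charmatrix M).map (Polynomial.compRingHom (-X : R[X])) = -charmatrix (-M) := by
    refine Matrix.ext fun i j => ?_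
    by_cases h : i = j
    · subst h
      rw [Matrix.neg_apply, charmatrix_apply_eq, map_apply, charmatrix_apply_eq]
      simp only [coe_compRingHom, sub_comp, X_comp, C_comp, Matrix.neg_apply, map_neg]
      ring
    · rw [Matrix.neg_apply, charmatrix_apply_ne _ _ _ h, map_apply, charmatrix_apply_ne _ _ _ h]
      simp only [coe_compRingHom, C_comp, Matrix.neg_apply, map_neg, neg_neg]
  rw [h1, h2, det_neg, ← mul_assoc, ← mul_pow, neg_mul_neg, one_mul, one_pow, one_mul,
    Matrix.charpoly]

/-- The roots of `χ_{−M}` are the negatives of the roots of `χ_M` (over an integral domain). [folklore] -/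
theorem roots_charpoly_neg {R : Type*} [CommRing R] [IsDomain R] (M : Matrix n n R) :
    (-M).charpoly.roots = M.charpoly.roots.map fun x => -x := by
  rw [charpoly_neg_eq, ← roots_comp_neg_X]
  rcases neg_one_pow_eq_or R[X] (Fintype.card n) with h | h
  · rw [h, one_mul]
  · rw [h, neg_one_mul, roots_neg]

/-- **Symmetric spectrum from an anti-commuting conjugation**: if `P` is invertible and
`P A P⁻¹ = −A` then the multiset of roots of `χ_A` is invariant under `z ↦ −z`. [folklore] -/
theorem roots_charpoly_map_neg_of_conj_eq_neg {R : Type*} [CommRing R] [IsDomain R]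
    (P : (Matrix n n R)ˣ) (A : Matrix n n R) (h : P.val * A * P.val⁻¹ = -A) :
    A.charpoly.roots.map (fun x => -x) = A.charpoly.roots := by
  rw [← roots_charpoly_neg, ← h, charpoly_units_conj]

/-- **Half the spectrum is negative**: an invertible Hermitian matrix that is conjugate to its
negative has as many negative as positive eigenvalues, `2 N₋ = dim`. [folklore] -/
theorem two_mul_countP_neg_eq_card_of_isHermitian {A : Matrix n n ℂ} (hA : A.IsHermitian)
    (hdet : A.det ≠ 0) (P : (Matrix n n ℂ)ˣ) (h : P.val * A * P.val⁻¹ = -A) :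
    2 * A.charpoly.roots.countP (fun z => z.re < 0) = Fintype.card n := by
  have hsym := roots_charpoly_map_neg_of_conj_eq_neg P A h
  have hpos : A.charpoly.roots.countP (fun z => 0 < z.re) =
      A.charpoly.roots.countP (fun z => z.re < 0) := by
    conv_lhs => rw [← hsym]
    rw [Multiset.countP_map]
    simp only [Complex.neg_re, Left.neg_pos_iff]
    rw [Multiset.countP_eq_card_filter]
  have := countP_neg_add_countP_pos_of_isHermitian hA hdet
  omega

end Spectral

/-! ### Coordinates under a unit shift -/

section FluxSector

variable {L : ℕ}


/-- A unit shift in direction `μ` leaves the other coordinates unchanged. [folklore] -/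
theorem site_shift_apply_of_ne {d : ℕ} (x : TorusSite d L) {μ ρ : Fin d} (h : ρ ≠ μ) :
    (Site.shift x μ) ρ = x ρ := by
  simp [Site.shift, Pi.single_eq_of_ne h]

/-- A unit shift in direction `μ` adds `1` to the `μ`-th coordinate. [folklore] -/
theorem site_shift_apply_self {d : ℕ} (x : TorusSite d L) (μ : Fin d) :
    (Site.shift x μ) μ = x μ + 1 := by
  simp [Site.shift]

/-- The representative in `[0, L)` of the shifted coordinate: `L − 1 ↦ 0`, otherwise `+1`. [folklore] -/
theorem val_site_shift_self [NeZero L] {d : ℕ} (x : TorusSite d L) (μ : Fin d) :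
    ((Site.shift x μ) μ).val = if (x μ).val = L - 1 then 0 else (x μ).val + 1 := by
  rw [site_shift_apply_self, ZMod.val_add, ZMod.val_one_eq_one_mod, Nat.add_mod_mod]
  have hlt : (x μ).val < L := ZMod.val_lt _
  have hL : 1 ≤ L := NeZero.one_le
  split_ifs with h
  · rw [h, Nat.sub_add_cancel hL, Nat.mod_self]
  · exact Nat.mod_eq_of_lt (by omega)

/-- The same, over `ℝ`: `(x + ν̂)_ρ = x_ρ + δ_{ρν} (1 − L δ_{x_ν, L−1})`. [folklore] -/
theorem cast_val_site_shift [NeZero L] {d : ℕ} (x : TorusSite d L) (ν ρ : Fin d) :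
    ((((Site.shift x ν) ρ).val : ℕ) : ℝ) =
      ((x ρ).val : ℝ) +
        if ρ = ν then 1 - (L : ℝ) * (if (x ν).val = L - 1 then 1 else 0) else 0 := by
  by_cases h : ρ = ν
  · subst h
    rw [val_site_shift_self, if_pos rfl]
    have hL : 1 ≤ L := NeZero.one_le
    split_ifs with h1
    · rw [h1, Nat.cast_sub hL]
      push_cast
      ring
    · push_cast
      ring
  · rw [site_shift_apply_of_ne x h, if_neg h, add_zero]

/-- How the weighted coordinate sums in `fluxSectorPhase` change under a unit shift. [folklore] -/
theorem sum_ite_mul_val_site_shift [NeZero L] (m : Fin 4 → Fin 4 → ℤ) (x : TorusSite 4 L)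
    (μ ν : Fin 4) (P : Fin 4 → Prop) [DecidablePred P] :
    (∑ ρ : Fin 4, if P ρ then (m μ ρ : ℝ) * ((((Site.shift x ν) ρ).val : ℕ) : ℝ) else 0) =
      (∑ ρ : Fin 4, if P ρ then (m μ ρ : ℝ) * (((x ρ).val : ℕ) : ℝ) else 0) +
        if P ν then (m μ ν : ℝ) * (1 - (L : ℝ) * (if (x ν).val = L - 1 then 1 else 0)) else 0 := by
  have key : ∀ ρ : Fin 4,
      (if P ρ then (m μ ρ : ℝ) * ((((Site.shift x ν) ρ).val : ℕ) : ℝ) else 0) =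
        (if P ρ then (m μ ρ : ℝ) * (((x ρ).val : ℕ) : ℝ) else 0) +
          if ρ = ν then
            (if P ρ then (m μ ρ : ℝ) * (1 - (L : ℝ) * (if (x ν).val = L - 1 then 1 else 0)) else 0)
          else 0 := by
    intro ρ
    rw [cast_val_site_shift x ν ρ]
    by_cases hρ : ρ = ν
    · subst hρ
      simp only [if_true]
      split_ifs <;> ring
    · simp only [if_neg hρ, add_zero]
  simp_rw [key, Finset.sum_add_distrib, Finset.sum_ite_eq', Finset.mem_univ, if_true]

/-- **Change of Lüscher's phase under a transverse unit shift**: for `ν ≠ μ`,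
`φ(x + ν̂, μ) − φ(x, μ) = −(2π/L²) (L δ_{x_μ,L−1} 𝟙[μ<ν] + 𝟙[ν<μ]) m_{μν} (1 − L δ_{x_ν,L−1})`. [folklore] -/
theorem fluxSectorPhase_site_shift_sub [NeZero L] (m : Fin 4 → Fin 4 → ℤ) (x : TorusSite 4 L)
    {μ ν : Fin 4} (hne : ν ≠ μ) :
    fluxSectorPhase L m (Site.shift x ν) μ - fluxSectorPhase L m x μ =
      -(2 * Real.pi / (L : ℝ) ^ 2) *
        (((L : ℝ) * (if (x μ).val = L - 1 then 1 else 0) * (if μ < ν then 1 else 0) +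
            (if ν < μ then 1 else 0)) *
          ((m μ ν : ℝ) * (1 - (L : ℝ) * (if (x ν).val = L - 1 then 1 else 0)))) := by
  simp only [fluxSectorPhase]
  rw [site_shift_apply_of_ne x hne.symm, sum_ite_mul_val_site_shift m x μ ν (fun ρ => μ < ρ),
    sum_ite_mul_val_site_shift m x μ ν (fun ρ => ρ < μ)]
  split_ifs <;> ring

/-- **The plaquette angle of `V_{[m]}` is `2π m_{μν}/L²` modulo `2π`** (`μ < ν`, `m` anti-symmetric):
`φ(x,μ) + φ(x+μ̂,ν) − φ(x+ν̂,μ) − φ(x,ν) = 2π m_{μν}/L² − 2π m_{μν} δ_{x_μ,L−1} δ_{x_ν,L−1}`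
(Lüscher 1999 §7.2: "can be shown to have constant field tensor equal to `2π m_{μν}/L²`").
[cite: Luscher1999AbelianChiral, §7.2 (the field V_[m])] -/
theorem fluxSectorPhase_plaquette [NeZero L] (m : Fin 4 → Fin 4 → ℤ) (hm : ∀ μ ν, m ν μ = -m μ ν)
    (x : TorusSite 4 L) {μ ν : Fin 4} (hμν : μ < ν) :
    ∃ k : ℤ, fluxSectorPhase L m x μ + fluxSectorPhase L m (Site.shift x μ) ν -
        fluxSectorPhase L m (Site.shift x ν) μ - fluxSectorPhase L m x ν =
      2 * Real.pi / (L : ℝ) ^ 2 * (m μ ν : ℝ) + k * (2 * Real.pi) := by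
  have h1 := fluxSectorPhase_site_shift_sub m x (μ := μ) (ν := ν) (ne_of_gt hμν)
  have h2 := fluxSectorPhase_site_shift_sub m x (μ := ν) (ν := μ) (ne_of_lt hμν)
  rw [if_pos hμν, if_neg (not_lt.mpr hμν.le)] at h1
  rw [if_neg (not_lt.mpr hμν.le), if_pos hμν, hm μ ν] at h2
  have hL : (L : ℝ) ≠ 0 := Nat.cast_ne_zero.mpr (NeZero.ne L)
  set c : ℝ := 2 * Real.pi / (L : ℝ) ^ 2 with hc
  have h2pi : 2 * Real.pi = c * (L : ℝ) ^ 2 := by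
    rw [hc]; field_simp
  refine ⟨-(m μ ν * (if (x μ).val = L - 1 then 1 else 0) * (if (x ν).val = L - 1 then 1 else 0)), ?_⟩
  rw [h2pi]
  split_ifs at h1 h2 ⊢ <;> push_cast at h1 h2 ⊢ <;> linear_combination h2 - h1


/-! ### Constant field tensor, admissibility, gap -/


/-- Reversing the orientation of a plaquette inverts its holonomy (any group). [folklore] -/
private theorem plaquetteHolonomy_rev {d : ℕ} {G : Type*} [Group G] (U : GaugeConfig d L G)
    (x : Site d L) (i j : Fin d) :
    plaquetteHolonomy U x j i = (plaquetteHolonomy U x i j)⁻¹ := by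
  simp only [plaquetteHolonomy, _root_.mul_inv_rev, inv_inv, mul_assoc]

/-- **Lüscher's flux-sector field has constant field tensor `2π m_{μν}/L²`** (Lüscher 1999, §7.2,
the sentence after (7.10)): for an anti-symmetric integer tensor `m` and `L ≥ 1`, every plaquette
holonomy of `V_{[m]}` in the `(μ, ν)` plane equals `exp(2πi m_{μν}/L²)` (all `μ, ν`; for `μ = ν`
both sides are `1`, for `μ > ν` both sides are the inverses of the `(ν, μ)` ones). [cite: Luscher1999AbelianChiral, §7.2 (the field V_[m])] -/
theorem plaquetteHolonomy_fluxSectorField [NeZero L] (m : Fin 4 → Fin 4 → ℤ)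
    (hm : ∀ μ ν, m ν μ = -m μ ν) (x : TorusSite 4 L) (μ ν : Fin 4) :
    plaquetteHolonomy (fluxSectorField L m) x μ ν =
      Circle.exp (2 * Real.pi * (m μ ν : ℝ) / (L : ℝ) ^ 2) := by
  -- the holonomy is `exp` of the oriented sum of the four phases
  have hexp : ∀ μ ν : Fin 4, plaquetteHolonomy (fluxSectorField L m) x μ ν =
      Circle.exp (fluxSectorPhase L m x μ + fluxSectorPhase L m (Site.shift x μ) ν -
        fluxSectorPhase L m (Site.shift x ν) μ - fluxSectorPhase L m x ν) := by
    intro μ ν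
    rw [Circle.exp_sub, Circle.exp_sub, Circle.exp_add, plaquetteHolonomy]
    simp only [fluxSectorField, div_eq_mul_inv]
  -- the case `μ < ν`
  have hlt : ∀ μ ν : Fin 4, μ < ν → plaquetteHolonomy (fluxSectorField L m) x μ ν =
      Circle.exp (2 * Real.pi * (m μ ν : ℝ) / (L : ℝ) ^ 2) := by
    intro μ ν h
    obtain ⟨k, hk⟩ := fluxSectorPhase_plaquette m hm x h
    rw [hexp, hk, Circle.exp_eq_exp]
    exact ⟨k, by ring⟩
  rcases lt_trichotomy μ ν with h | h | h
  · exact hlt μ ν h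
  · subst h
    have h0 : m μ μ = 0 := by
      have := hm μ μ; omega
    rw [h0, plaquetteHolonomy]
    simp
  · rw [plaquetteHolonomy_rev, hlt ν μ h, ← Circle.exp_neg, hm ν μ]
    congr 1
    push_cast
    ring

open scoped Matrix.Norms.L2Operator in
/-- `‖1 − e^{iθ}‖ ≤ |θ|` for the `U(1)` link variable read as a `1 × 1` matrix (operator norm). [folklore] -/
theorem norm_one_sub_u1Rep_exp_le (θ : ℝ) :
    ‖(1 : Matrix (Fin 1) (Fin 1) ℂ) - u1Rep (Circle.exp θ)‖ ≤ |θ| := by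
  refine (norm_one_sub_le_sqrt_two_mul_trace_deficit _ (u1Rep_mem_unitaryGroup _)).trans ?_
  have htr : (u1Rep (Circle.exp θ)).trace.re = Real.cos θ := by
    rw [u1Rep_apply, Matrix.trace, Fin.sum_univ_one]
    simp [Matrix.scalar_apply, Circle.coe_exp, Complex.exp_re, mul_comm]
  rw [htr, ← Real.sqrt_sq_eq_abs]
  refine Real.sqrt_le_sqrt ?_
  have := Real.one_sub_sq_div_two_le_cos (x := θ)
  push_cast
  linarith

open scoped Matrix.Norms.L2Operator in
/-- **The plaquettes of `V_{[m]}` are `2π|m_{μν}|/L²`-close to `1`**: `‖1 − V_{[m]}(p)‖ ≤ 2π|m_{μν}|/L²`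
for every plaquette `p` in the `(μ, ν)` plane. [cite: Luscher1999AbelianChiral, §7.2 (the bound before (7.10))] -/
theorem norm_one_sub_u1Rep_plaquetteHolonomy_fluxSectorField_le [NeZero L] (m : Fin 4 → Fin 4 → ℤ)
    (hm : ∀ μ ν, m ν μ = -m μ ν) (x : TorusSite 4 L) (μ ν : Fin 4) :
    ‖(1 : Matrix (Fin 1) (Fin 1) ℂ) - u1Rep (plaquetteHolonomy (fluxSectorField L m) x μ ν)‖ ≤
      2 * Real.pi * |(m μ ν : ℝ)| / (L : ℝ) ^ 2 := by
  rw [plaquetteHolonomy_fluxSectorField m hm x μ ν]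
  refine (norm_one_sub_u1Rep_exp_le _).trans (le_of_eq ?_)
  rw [abs_div, abs_mul, abs_of_pos Real.two_pi_pos, abs_of_nonneg (by positivity : (0 : ℝ) ≤ (L : ℝ) ^ 2)]

open scoped Matrix.Norms.L2Operator in
/-- **`V_{[m]}` is admissible with `ε = 1/50`** when `2π|m_{μν}| ≤ L²/50` (the hypothesis of
`IOSFluxSectorIndex`): `‖1 − V_{[m]}(p)‖ ≤ 1/50` for all plaquettes. [folklore] -/
theorem isNormAdmissible_fluxSectorField [NeZero L] (m : Fin 4 → Fin 4 → ℤ)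
    (hm : ∀ μ ν, m ν μ = -m μ ν) (hb : ∀ μ ν, 2 * Real.pi * |(m μ ν : ℝ)| ≤ (L : ℝ) ^ 2 / 50) :
    IsNormAdmissible u1Rep (fluxSectorField L m) (1 / 50) := by
  intro p
  refine (norm_one_sub_u1Rep_plaquetteHolonomy_fluxSectorField_le m hm _ _ _).trans ?_
  have hL : (0 : ℝ) < (L : ℝ) ^ 2 := by
    have : (0 : ℝ) < L := Nat.cast_pos.mpr (NeZero.pos L)
    positivity
  rw [div_le_iff₀ hL]
  linarith [hb p.2.1.1 p.2.1.2]

/-- **Neuberger's gap for `V_{[m]}`**: under the hypothesis of `IOSFluxSectorIndex`,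
`‖D_W(V_{[m]}, −1, 1) v‖² ≥ (2/5)‖v‖²` (`m² − 30δ` at `m = −1`, `δ = 1/50`), so the Hermitian
Wilson–Dirac operator at the overlap point has no zero modes. [cite: Neuberger2000Bounds, §Lower bound] -/
theorem fluxSectorField_wilsonDirac_normSq_ge [NeZero L] (m : Fin 4 → Fin 4 → ℤ)
    (hm : ∀ μ ν, m ν μ = -m μ ν) (hb : ∀ μ ν, 2 * Real.pi * |(m μ ν : ℝ)| ≤ (L : ℝ) ^ 2 / 50)
    (v : TorusSite 4 L × Fin 1 × Fin 4 → ℂ) :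
    (2 / 5 : ℝ) * ∑ i, ‖v i‖ ^ 2 ≤ ∑ i, ‖(wilsonDirac u1Rep (fluxSectorField L m) (-1) 1 *ᵥ v) i‖ ^ 2 := by
  have hL : (0 : ℝ) < (L : ℝ) ^ 2 := by
    have : (0 : ℝ) < L := Nat.cast_pos.mpr (NeZero.pos L)
    positivity
  have h := wilsonDirac_normSq_mulVec_ge_of_plaquette u1Rep u1Rep_mem_unitaryGroup
    (fluxSectorField L m) (-1) (le_refl _) (1 / 50) (by norm_num)
    (fun y μ ν _ => by
      refine (norm_one_sub_u1Rep_plaquetteHolonomy_fluxSectorField_le m hm y μ ν).trans ?_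
      rw [div_le_iff₀ hL]
      linarith [hb μ ν]) v
  norm_num at h
  linarith

/-- The Hermitian Wilson–Dirac operator of `V_{[m]}` at the overlap point is the tree's `overlapKernel`
at `m₀ = 1`. [folklore] -/
theorem overlapKernel_fluxSectorField_one [NeZero L] (m : Fin 4 → Fin 4 → ℤ) :
    overlapKernel u1Rep (fluxSectorField L m) 1 =
      spinorLift gammaFive * wilsonDirac u1Rep (fluxSectorField L m) (-1) 1 := rfl

/-- **`H = Γ₅ D_W(V_{[m]}, −1, 1)` is Hermitian.** [cite: Neuberger1998, eq. (2)] -/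
theorem isHermitian_gammaFive_mul_wilsonDirac_fluxSectorField [NeZero L] (m : Fin 4 → Fin 4 → ℤ) :
    (spinorLift gammaFive * wilsonDirac u1Rep (fluxSectorField L m) (-1) 1).IsHermitian := by
  rw [← overlapKernel_fluxSectorField_one]
  exact overlapKernel_isHermitian u1Rep u1Rep_mem_unitaryGroup _ _

/-- **`H = Γ₅ D_W(V_{[m]}, −1, 1)` has non-zero determinant** under the hypothesis of
`IOSFluxSectorIndex` (Neuberger's gap). [cite: Neuberger2000Bounds, §Lower bound] -/
theorem det_gammaFive_mul_wilsonDirac_fluxSectorField_ne_zero [NeZero L] (m : Fin 4 → Fin 4 → ℤ)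
    (hm : ∀ μ ν, m ν μ = -m μ ν) (hb : ∀ μ ν, 2 * Real.pi * |(m μ ν : ℝ)| ≤ (L : ℝ) ^ 2 / 50) :
    (spinorLift gammaFive * wilsonDirac u1Rep (fluxSectorField L m) (-1) 1).det ≠ 0 := by
  rw [Matrix.det_mul]
  refine mul_ne_zero ?_ ?_
  · intro h0
    have h1 := congrArg Matrix.det (spinorLift_gammaFive_mul_self (L := L) (N := 1))
    rw [Matrix.det_mul, h0, zero_mul, Matrix.det_one] at h1
    exact zero_ne_one h1
  · intro h0
    obtain ⟨v, hv0, hv⟩ := Matrix.exists_mulVec_eq_zero_iff.mpr h0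
    have h := fluxSectorField_wilsonDirac_normSq_ge m hm hb v
    rw [hv] at h
    simp only [Pi.zero_apply, norm_zero, ne_eq, OfNat.ofNat_ne_zero, not_false_eq_true, zero_pow,
      Finset.sum_const_zero] at h
    have hpos : 0 < ∑ i, ‖v i‖ ^ 2 := by
      obtain ⟨i, hi⟩ := Function.ne_iff.mp hv0
      exact Finset.sum_pos' (fun _ _ => by positivity) ⟨i, Finset.mem_univ _, by positivity⟩
    linarith


/-- **`N₋ + N₊ = 4L⁴`** for `H = Γ₅ D_W(V_{[m]}, −1, 1)` under the hypothesis of `IOSFluxSectorIndex`: the Hermitian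
Wilson–Dirac operator of the unit-charge fermion in Lüscher's flux-sector field has no zero modes, so its `4L⁴`
eigenvalues (with multiplicity) split into negative and positive ones. [folklore] -/
theorem countP_neg_add_countP_pos_fluxSectorField [NeZero L] (m : Fin 4 → Fin 4 → ℤ)
    (hm : ∀ μ ν, m ν μ = -m μ ν) (hb : ∀ μ ν, 2 * Real.pi * |(m μ ν : ℝ)| ≤ (L : ℝ) ^ 2 / 50) :
    (spinorLift gammaFive * wilsonDirac u1Rep (fluxSectorField L m) (-1) 1).charpoly.roots.countP
        (fun z : ℂ => z.re < 0) +
      (spinorLift gammaFive * wilsonDirac u1Rep (fluxSectorField L m) (-1) 1).charpoly.roots.countP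
        (fun z : ℂ => 0 < z.re) = 4 * L ^ 4 := by
  rw [countP_neg_add_countP_pos_of_isHermitian (isHermitian_gammaFive_mul_wilsonDirac_fluxSectorField m)
    (det_gammaFive_mul_wilsonDirac_fluxSectorField_ne_zero m hm hb)]
  simp only [Fintype.card_prod, Fintype.card_pi, ZMod.card, Finset.prod_const, Finset.card_univ,
    Fintype.card_fin]
  ring

end FluxSector

end Literature.MathematicalPhysics.QuantumLattice

end
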